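import Literature.Computability.AlgebraicComplexity.BorderRankExtension
import Literature.Computability.AlgebraicComplexity.KoszulFlatteningGeneralDim
import HarnessLib

/-!
# The linear extension sieve: `bR(T) > r` when no new slice passes the tight Koszul flattenings

Topic `Literature/Computability/AlgebraicComplexity`; a trunk-independent TOOL, the second half of the
one-step extension method whose first half is `BorderRankExtension.lean` (lemma (E1),
`exists_extendSlice_of_finrank_sliceSpan_lt`: a tensor `t ∈ K^ι ⊗ K^κ ⊗ K^μ` with `|ι| < r = bR(t)`
has a new slice `Z ∉ t(A^*)` with `bR(t + e_new ⊗ Z) ≤ r`; Jagiełła–Jelisiejew, arXiv:2604.24879,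
Thm. 2.2 / Lemma 2.7).  Everything here is PROVED over an arbitrary field `K`; nothing is specific to
one tensor.  HONEST FRAMING (pub-tensor bundle): the value is DECIDABLE VERDICTS / CERTIFICATES about
explicit small tensors (the rows of the certificate tables that import this file) — a THEOREM-level
library item, NOT progress on the exponent of matrix multiplication.

## The sieve

Fix a "role": a Koszul flattening `F(s) = (s ⊗ K^κ ⊗ K^μ)^{∧p}_{A'}` after a linear map
`M : K^κ → A' = K^q` on the SECOND factor, with the (to be extended) first factor in the SOURCE
(`srcFlattening q p M s`, rows `(T, c)`, `|T| = p+1`, columns `(S, a)`, `|S| = p`;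
Landsberg–Ottaviani: `rank F(s) ≤ C(q-1,p) · bR(s)`, `rank_srcFlattening_le`).  Extending `t` by a
new slice `Z` adds the new columns `(S, new)`, whose entries are LINEAR in `Z`
(`srcFlattening_extendSlice_none`), while the old columns are those of `F(t)`
(`srcFlattening_extendSlice_submatrix`).  If the role is TIGHT for `r`, i.e.
`rank F(t) ≥ C(q-1,p) · r`, then `bR(t + e_new ⊗ Z) ≤ r` forces every new column into the column
space of `F(t)`: for every `y` in the left kernel of `F(t)` and every `S`, the linear condition
`ℓ_{y,S}(Z) = ∑_{(T,c)} y_{T,c} ∑_j (e_T^* (M e_j ∧ e_S)) Z_{j c} = 0` holds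
(`srcFlattening_condition`, from the column sieve `vecMul_eq_zero_of_rank_le`).  Role 3 (exterior map
on the THIRD factor) is role 1 of the `κ ↔ μ` swapped tensor with `Zᵀ` (`algBorderRank_swap₂₃`).
Collecting conditions into a linear map `Λ : K^{κ×μ} → K^N` with `Λ(t(A^*)) = 0`: if
`rank Λ ≥ |κ||μ| - dim t(A^*)` then `ker Λ = t(A^*)` (`mem_of_le_ker_of_finrank`), so NO admissible
`Z ∉ t(A^*)` exists and (E1) gives `bR(t) > r` (`lt_algBorderRank_of_card_lt_of_forall_extendSlice`).

## Main results

* `srcFlattening`, `rank_srcFlattening_le`, `srcFlattening_condition` — the role flattening and the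
  tight-role linear conditions on a new slice (any `q`, `p`, any finite index types).
* `SieveCert.check` / `SieveCert.lt_algBorderRank_of_check` — an INTEGER certificate format on codes
  (`q = 4`, `p = 1`, exterior maps `M1 : K^b → K^4`, `M3 : K^c → K^4` as integer row lists, the
  presentation `KYGen.kyEntry4` of `KoszulFlatteningGeneralDim.lean`, unit-pivot row certificates
  `intTriCheckUnit` of `IntRowCertificateUnitPivot.lean` for: the old flattening ranks `≥ 3r`, the
  rank of `Λ` `≥ bc - a`, the rank of the slice matrix `≥ a`; plus `decide`-able vanishing checks
  `y · F(t) = 0` and `Λ · slices = 0`) and its soundness: `check … = true`, `a < r ≤ bR(T ⊗ K)` imply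
  `r < bR(T ⊗ K)` over EVERY field `K` (unit pivots: no characteristic hypothesis).

## Not here

Deeper sieves (a forced extension direction followed by a second step, torus/Borel-fixed directions,
Jagiełła–Jelisiejew Thm. 1.8) and the per-tensor tables.

## References

* J. M. Landsberg, G. Ottaviani, *New lower bounds for the border rank of matrix multiplication*,
  Theory of Computing 11 (2015), Thm. 2.1 (Koszul flattenings) [LandsbergOttaviani2015].
* J. M. Landsberg, *Geometry and complexity theory*, CUP 2017, §2.4.2 (2.4.5)–(2.4.6) [LandsbergGCT2017].
* J. Jagiełła, J. Jelisiejew, *Unrestrictions and concise secant varieties*, arXiv:2604.24879 (2026),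
  Thm. 2.2, Lemma 2.7 [JagiellaJelisiejew2026Unrestrictions].
* J. Jelisiejew, J. M. Landsberg, A. Pal, *Concise tensors of minimal border rank*, Math. Ann. (2023),
  Prop. 3.3 (corank-one extensions) [JelisiejewLandsbergPal2023].
-/

open scoped BigOperators Matrix
open Matrix

namespace Literature.Computability.AlgebraicComplexity

open Literature.LinearAlgebra.Matrix

universe u

/-! ## A. Linear algebra: the column sieve and the dimension count -/

section LinAlg

variable {K : Type*} [Field K]

/-- **Column sieve.** If some columns of `M` (selected by `f`) already have rank `≥ cap ≥ rank M`, then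
every vector `y` orthogonal to the selected columns is orthogonal to ALL columns of `M` (the selected
columns span the column space). [folklore] -/
theorem vecMul_eq_zero_of_rank_le {m n n₀ : Type*} [Fintype m] [Fintype n] [Fintype n₀]
    (M : Matrix m n K) (f : n₀ → n) (y : m → K) (hy : y ᵥ* M.submatrix id f = 0) {cap : ℕ}
    (hcap : cap ≤ (M.submatrix id f).rank) (hM : M.rank ≤ cap) : y ᵥ* M = 0 := by
  classical
  have hle : LinearMap.range (M.submatrix id f).mulVecLin ≤ LinearMap.range M.mulVecLin := by
    rw [Matrix.range_mulVecLin, Matrix.range_mulVecLin]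
    refine Submodule.span_mono ?_
    rintro _ ⟨j, rfl⟩
    exact ⟨f j, funext fun i => rfl⟩
  have heq : LinearMap.range (M.submatrix id f).mulVecLin = LinearMap.range M.mulVecLin := by
    refine Submodule.eq_of_le_of_finrank_le hle ?_
    have h := hM.trans hcap
    unfold Matrix.rank at h
    exact h
  have key : ∀ v ∈ LinearMap.range (M.submatrix id f).mulVecLin, y ⬝ᵥ v = 0 := by
    intro v hv
    rw [Matrix.range_mulVecLin] at hv
    induction hv using Submodule.span_induction with
    | mem v hv =>
      obtain ⟨j, rfl⟩ := hv
      exact congr_fun hy j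
    | zero => simp
    | add v w _ _ hv hw => rw [dotProduct_add, hv, hw, add_zero]
    | smul a v _ hv => rw [dotProduct_smul, hv, smul_zero]
  funext j
  have hmem : M.col j ∈ LinearMap.range M.mulVecLin := by
    rw [Matrix.range_mulVecLin]
    exact Submodule.subset_span ⟨j, rfl⟩
  rw [← heq] at hmem
  exact key _ hmem

/-- **Dimension count.** If `S ≤ ker Ψ`, `dim V ≤ d + e`, `rank Ψ ≥ d` and `dim S ≥ e`, then
`ker Ψ = S`; in particular every `Z` with `Ψ Z = 0` lies in `S`. [folklore] -/
theorem mem_of_le_ker_of_finrank {V : Type*} [AddCommGroup V] [Module K V] [FiniteDimensional K V]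
    {N : Type*} [AddCommGroup N] [Module K N] (Ψ : V →ₗ[K] N) (S : Submodule K V)
    (hS : S ≤ LinearMap.ker Ψ) {d e : ℕ} (hd : Module.finrank K V ≤ d + e)
    (hΨ : d ≤ Module.finrank K (LinearMap.range Ψ)) (hSe : e ≤ Module.finrank K S) {Z : V}
    (hZ : Ψ Z = 0) : Z ∈ S := by
  have hker := LinearMap.finrank_range_add_finrank_ker Ψ
  have h1 : Module.finrank K (LinearMap.ker Ψ) ≤ Module.finrank K S := by omega
  rw [Submodule.eq_of_le_of_finrank_le hS h1]
  exact hZ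

/-- `intCertRow` paired with an arbitrary column (not necessarily integer): the list sum of
`λ · g (fr r)`. [folklore] -/
theorem sum_intCertRow_mul' {m : Type*} [Fintype m] [DecidableEq m] (fr : ℕ → m) (g : m → K)
    (L : List (ℕ × ℤ)) :
    ∑ i, intCertRow (F := K) fr L i * g i = (L.map fun rc => (rc.2 : K) * g (fr rc.1)).sum := by
  induction L with
  | nil => simp [intCertRow]
  | cons rc L ih =>
    simp only [intCertRow, Pi.add_apply, add_mul, Finset.sum_add_distrib, ih, List.map_cons,
      List.sum_cons]
    congr 1
    simp only [Pi.single_apply, ite_mul, zero_mul, Finset.sum_ite_eq', Finset.mem_univ, if_true]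

end LinAlg

/-! ## B. The Koszul flattening of a one-slice extension in a role where the extended factor is the source -/

section Source

variable {K : Type u} [Field K] {ι κ μ : Type} [Fintype κ]

/-- The signed incidence `ε(T, S, x)`: `koszulSign S x` if `x ∉ S` and `T = S ∪ {x}`, else `0`
(the coefficient of `v x` in `(v ∧ e_S)_T`). [folklore] -/
def wedgeInc {q : ℕ} (T S : Finset (Fin q)) (x : Fin q) : ℤ :=
  if x ∉ S ∧ T = insert x S then koszulSign S x else 0

/-- `(v ∧ e_S)_T = ∑_x ε(T, S, x) v_x`. [folklore] -/
theorem wedgeMatrix_eq_sum_wedgeInc {q : ℕ} (v : Fin q → K) (T S : Finset (Fin q)) :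
    wedgeMatrix v T S = ∑ x, (wedgeInc T S x : K) * v x := by
  rw [wedgeMatrix_apply]
  refine Finset.sum_congr rfl fun x _ => ?_
  unfold wedgeInc
  split_ifs <;> simp

/-- The Koszul flattening `Λ^p K^q ⊗ (K^ι')^* → Λ^{p+1} K^q ⊗ K^μ` of `s ∈ K^ι' ⊗ K^κ ⊗ K^μ` in the role
"exterior factor `κ` (through `M : K^κ → K^q`), SOURCE factor `ι'`, rows `μ`" — the arrangement in
which a new slice along `ι'` enters through new COLUMNS only.
[cite: LandsbergGCT2017, §2.4.2 (2.4.5)-(2.4.6)] -/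
def srcFlattening (q p : ℕ) {ι' : Type} (M : Matrix (Fin q) κ K) (s : ι' → κ → μ → K) :
    Matrix (PSub q (p + 1) × μ) (PSub q p × ι') K :=
  koszulFlatteningGen q p M.mulVecLin (fun b a c => s a b c)

/-- The old columns of the flattening of `extendSlice t Z` form the flattening of `t`. [folklore] -/
theorem srcFlattening_extendSlice_submatrix (q p : ℕ) (M : Matrix (Fin q) κ K) (t : ι → κ → μ → K)
    (Z : κ → μ → K) :
    (srcFlattening q p M (extendSlice t Z)).submatrix id (fun x : PSub q p × ι => (x.1, some x.2)) =
      srcFlattening q p M t := by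
  ext r x
  rfl

/-- The new column `(S, new)` of the flattening of `extendSlice t Z`: entry `(Φ(Z(·, c)) ∧ e_S)_T` at
row `(T, c)` — linear in `Z`, independent of `t`. [folklore] -/
theorem srcFlattening_extendSlice_none (q p : ℕ) (M : Matrix (Fin q) κ K) (t : ι → κ → μ → K)
    (Z : κ → μ → K) (r : PSub q (p + 1) × μ) (S : PSub q p) :
    srcFlattening q p M (extendSlice t Z) r (S, none) =
      ∑ j, (∑ x, (wedgeInc r.1.1 S.1 x : K) * M x j) * Z j r.2 := by
  show wedgeMatrix (M.mulVecLin fun b => Z b r.2) r.1.1 S.1 = _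
  rw [wedgeMatrix_eq_sum_wedgeInc]
  simp only [Matrix.mulVecLin_apply, Matrix.mulVec, dotProduct, Finset.mul_sum, Finset.sum_mul]
  rw [Finset.sum_comm]
  refine Finset.sum_congr rfl fun j _ => Finset.sum_congr rfl fun x _ => ?_
  ring

variable [Fintype ι] [Fintype μ] [DecidableEq ι] [DecidableEq κ] [DecidableEq μ]

/-- **Landsberg–Ottaviani in the source role**: `rank ≤ C(q-1, p) · bR(s)` (the arrangement
`(b, a, c) ↦ s a b c` has the border rank of `s`). [cite: LandsbergOttaviani2015, Thm 2.1] [cite: Blaser2013, §5.1 (permutation of tensors)] -/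
theorem rank_srcFlattening_le (q p : ℕ) {ι' : Type} [Fintype ι'] [DecidableEq ι']
    (M : Matrix (Fin q) κ K) (s : ι' → κ → μ → K) :
    (srcFlattening q p M s).rank ≤ (q - 1).choose p * algBorderRank s := by
  have h := rank_koszulFlatteningGen_le_choose_mul_algBorderRank q p M (fun b a c => s a b c)
  have e : algBorderRank (fun b a c => s a b c) = algBorderRank s := by
    rw [← algBorderRank_rotate s, ← algBorderRank_swap₂₃ (rotate s)]
    rfl
  rw [e] at h
  exact h

/-- **The linear condition of a tight source role.** If `bR(extendSlice t Z) ≤ r`, the old matrix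
already has rank `≥ C(q-1,p) · r`, and `y` is a left-kernel vector of the old matrix, then `y` kills
every new column: for the column `(S, new)`,
`∑_{(T,c)} y(T,c) · ∑_j (∑_x ε(T,S,x) M_{xj}) · Z_{jc} = 0`. [cite: LandsbergOttaviani2015, Thm 2.1] [cite: JagiellaJelisiejew2026Unrestrictions, Thm. 2.2 (use of the extension)] -/
theorem srcFlattening_condition (q p : ℕ) (M : Matrix (Fin q) κ K) (t : ι → κ → μ → K)
    (Z : κ → μ → K) {r : ℕ} (hZ : algBorderRank (extendSlice t Z) ≤ r)
    (hcap : (q - 1).choose p * r ≤ (srcFlattening q p M t).rank) (y : PSub q (p + 1) × μ → K)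
    (hy : y ᵥ* srcFlattening q p M t = 0) (S : PSub q p) :
    ∑ rr : PSub q (p + 1) × μ, y rr * ∑ j, (∑ x, (wedgeInc rr.1.1 S.1 x : K) * M x j) * Z j rr.2 = 0 := by
  have hrank : (srcFlattening q p M (extendSlice t Z)).rank ≤ (q - 1).choose p * r :=
    (rank_srcFlattening_le q p M (extendSlice t Z)).trans (Nat.mul_le_mul_left _ hZ)
  have hcap' : (q - 1).choose p * r ≤ ((srcFlattening q p M (extendSlice t Z)).submatrix id
      (fun x : PSub q p × ι => (x.1, some x.2))).rank := by
    rw [srcFlattening_extendSlice_submatrix]; exact hcap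
  have hy' : y ᵥ* (srcFlattening q p M (extendSlice t Z)).submatrix id
      (fun x : PSub q p × ι => (x.1, some x.2)) = 0 := by
    rw [srcFlattening_extendSlice_submatrix]; exact hy
  have key := congr_fun (vecMul_eq_zero_of_rank_le _ _ y hy' hcap' hrank) (S, none)
  simp only [Matrix.vecMul, dotProduct, Pi.zero_apply, srcFlattening_extendSlice_none] at key
  exact key

end Source

/-! ## C. Integer certificates on codes (`q = 4`, `p = 1`, extended factor first, roles 1 and 3) -/

namespace SieveCert

open KYCert KYGen

/-- A sieve condition on codes: `(role, y, s)` — `role = 1` (exterior = second factor, rows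
`(pair, third index)`, row code `6·c`-style `P * c + l`) or anything else for role `3` (exterior = third
factor, rows `(pair, second index)`, code `P * b + j`); `y` a sparse integer left-kernel vector of the
old flattening as `(row code, coefficient)` pairs; `s < 4` the singleton of the new column. [folklore] -/
abbrev Cond : Type := ℕ × List (ℕ × ℤ) × ℕ

/-- The linear form `λ_{(role,y,s)}(j,l)` of a condition at the coordinate `(j,l)` of the new slice
`Z ∈ K^{b×c}` (exterior maps `M1 : K^b → K^4`, `M3 : K^c → K^4` as integer row lists):
role 1: `∑_{(r,λ) ∈ y, r % c = l} λ · ∑_x ε(r/c, s, x) M1[x][j]`; role 3: `∑_{r % b = j} λ · ∑_x ε(r/b, s, x) M3[x][l]`.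
[cite: LandsbergOttaviani2015, Thm 2.1] -/
def lamEntry (b c : ℕ) (M1 M3 : List (List ℤ)) (cd : Cond) (j l : ℕ) : ℤ :=
  if cd.1 = 1 then
    (cd.2.1.map fun rc => if rc.1 % c = l then
        rc.2 * lsum 4 (fun x => incZ4 (rc.1 / c % 6) (cd.2.2 % 4) x * mget M1 x j) else 0).sum
  else
    (cd.2.1.map fun rc => if rc.1 % b = j then
        rc.2 * lsum 4 (fun x => incZ4 (rc.1 / b % 6) (cd.2.2 % 4) x * mget M3 x l) else 0).sum

/-- The default (empty) condition, all of whose forms vanish. [folklore] -/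
def dflt : Cond := (0, [], 0)

/-- The condition matrix `Λ` on codes: row `k` (read mod `b*c`; rows beyond the list are zero),
column code `q = j*c + l`. [folklore] -/
def lamCode (b c : ℕ) (M1 M3 : List (List ℤ)) (conds : List Cond) (k q : ℕ) : ℤ :=
  lamEntry b c M1 M3 (conds.getD (k % (b * c)) dflt) (q / c % b) (q % c)

/-- `Λ` as an integer matrix with `b*c` rows (conditions, zero-padded) and columns `Fin b × Fin c`. [folklore] -/
def lamMat (b c : ℕ) (M1 M3 : List (List ℤ)) (conds : List Cond) :
    Matrix (Fin (b * c)) (Fin b × Fin c) ℤ :=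
  Matrix.of fun k p => lamEntry b c M1 M3 (conds.getD k dflt) p.1 p.2

/-- Vanishing of a condition's vector on the OLD flattening, on codes: `∑_{(r,λ)∈y} λ · M0[r][q] = 0`
for every column code `q < 4a` (`M0` = `KYGen.kyEntry4` of the arranged tensor). [folklore] -/
def condVanish (a b c : ℕ) [NeZero a] [NeZero b] [NeZero c] (T : Fin a → Fin b → Fin c → ℤ)
    (M1 M3 : List (List ℤ)) (cd : Cond) : Bool :=
  if cd.1 = 1 then
    (List.range (4 * a)).all fun qq =>
      (cd.2.1.map fun rc => rc.2 * kyEntry4 b a c M1 (fun j i l => T i j l) rc.1 qq).sum == 0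
  else
    (List.range (4 * a)).all fun qq =>
      (cd.2.1.map fun rc => rc.2 * kyEntry4 c a b M3 (fun l i j => T i j l) rc.1 qq).sum == 0

/-- `Λ` kills every slice `T(i,·,·)`, on codes. [folklore] -/
def slicesKilled (a b c : ℕ) [NeZero a] [NeZero b] [NeZero c] (T : Fin a → Fin b → Fin c → ℤ)
    (M1 M3 : List (List ℤ)) (conds : List Cond) : Bool :=
  (List.range (b * c)).all fun k => (List.range a).all fun i =>
    lsum b (fun j => lsum c fun l =>
      lamEntry b c M1 M3 (conds.getD k dflt) j l * T (finCode a i) (finCode b j) (finCode c l)) == 0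

/-- The slice matrix (`a × bc`) on codes. [folklore] -/
def slabCode (a b c : ℕ) [NeZero a] [NeZero b] [NeZero c] (T : Fin a → Fin b → Fin c → ℤ)
    (x q : ℕ) : ℤ :=
  T (finCode a x) (finCode b (q / c)) (finCode c q)

/-- **The sieve certificate check** for `r < bR(T)` (given `a < r ≤ bR(T)`): every condition vector
kills the old flattening of its role; each role in use has its old flattening of rank `≥ 3r` (unit-pivot
row certificate); `Λ` kills the slices; `rank Λ ≥ bc - a` and `rank(slices) ≥ a` (unit-pivot row
certificates). [cite: LandsbergOttaviani2015, Thm 2.1] [cite: JagiellaJelisiejew2026Unrestrictions, Thm. 2.2] -/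
def check (a b c r : ℕ) [NeZero a] [NeZero b] [NeZero c] (T : Fin a → Fin b → Fin c → ℤ)
    (M1 M3 : List (List ℤ)) (conds : List Cond) (rows1 : List (List (ℕ × ℤ))) (piv1 : List ℕ)
    (rows3 : List (List (ℕ × ℤ))) (piv3 : List ℕ) (rowsL : List (List (ℕ × ℤ))) (pivL : List ℕ)
    (rowsS : List (List (ℕ × ℤ))) (pivS : List ℕ) : Bool :=
  (conds.all fun cd => condVanish a b c T M1 M3 cd) &&
  (!(conds.any fun cd => cd.1 == 1) ||
    intTriCheckUnit (3 * r) (kyEntry4 b a c M1 (fun j i l => T i j l)) rows1 piv1) &&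
  (!(conds.any fun cd => !(cd.1 == 1)) ||
    intTriCheckUnit (3 * r) (kyEntry4 c a b M3 (fun l i j => T i j l)) rows3 piv3) &&
  slicesKilled a b c T M1 M3 conds &&
  intTriCheckUnit (b * c - a) (lamCode b c M1 M3 conds) rowsL pivL &&
  intTriCheckUnit a (slabCode a b c T) rowsS pivS

/-! ### Soundness -/

section Sound

variable {K : Type u} [Field K]

/-- Every column of the role flattening is a decoded code `< 4a`. [folklore] -/
theorem exists_colDec4 (a : ℕ) [NeZero a] (col : PSub 4 1 × Fin a) :
    ∃ qq, qq < 4 * a ∧ colDec4 a qq = col := by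
  obtain ⟨S, i⟩ := col
  obtain ⟨s, rfl⟩ : ∃ s : Fin 4, singOf4 s = S := by
    revert S; decide
  have ha : 0 < a := Nat.pos_of_ne_zero (NeZero.ne a)
  refine ⟨a * s + i, ?_, ?_⟩
  · have hs : (s : ℕ) + 1 ≤ 4 := s.isLt
    calc a * s + i < a * s + a := by omega
      _ = a * (s + 1) := by ring
      _ ≤ a * 4 := Nat.mul_le_mul_left _ hs
      _ = 4 * a := by ring
  · have h1 : (a * s + i) / a = s := by
      rw [Nat.mul_add_div ha, Nat.div_eq_of_lt i.isLt, add_zero]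
    have h2 : finCode 4 ((a * ↑s + ↑i) / a) = s := by
      rw [h1]; exact Fin.ext (Nat.mod_eq_of_lt s.isLt)
    have h3 : finCode a (a * ↑s + ↑i) = i := by
      refine Fin.ext ?_
      show (a * ↑s + ↑i) % a = i
      rw [Nat.mul_add_mod, Nat.mod_eq_of_lt i.isLt]
    simp only [colDec4, h2, h3]

/-- The old flattening of role 1 over `K` is the base change of the integer one presented by
`kyEntry4 b a c M (j,i,l ↦ T i j l)`. [cite: LandsbergGCT2017, §2.4.2 (2.4.6)] -/
theorem srcFlattening_eq_map {a b c : ℕ} (T : Fin a → Fin b → Fin c → ℤ) (M : List (List ℤ)) :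
    srcFlattening 4 1 ((mat4 b M).map (Int.cast : ℤ → K)) (fun i j l => (T i j l : K)) =
      (koszulFlatteningGen 4 1 (mat4 b M).mulVecLin (fun j i l => T i j l)).map (Int.cast : ℤ → K) :=
  (koszulFlatteningGen_mulVecLin_map 4 1 (Int.castRingHom K) (mat4 b M) (fun j i l => T i j l)).symm

/-- A unit-pivot row certificate of the integer role-1 flattening bounds the rank over `K`.
[cite: LandsbergOttaviani2015, Thm 2.1] -/
theorem le_rank_srcFlattening {a b c : ℕ} [NeZero a] [NeZero b] [NeZero c]
    (T : Fin a → Fin b → Fin c → ℤ) (M : List (List ℤ)) {n : ℕ} {rows : List (List (ℕ × ℤ))}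
    {piv : List ℕ} (h : intTriCheckUnit n (kyEntry4 b a c M (fun j i l => T i j l)) rows piv = true) :
    n ≤ (srcFlattening 4 1 ((mat4 b M).map (Int.cast : ℤ → K)) (fun i j l => (T i j l : K))).rank := by
  have e : kyEntry4 b a c M (fun j i l => T i j l) = fun r q =>
      koszulFlatteningGen 4 1 (mat4 b M).mulVecLin (fun j i l => T i j l) (rowDec4 c r) (colDec4 a q) :=
    funext fun r => funext fun q => kyEntry4_eq b a c M (fun j i l => T i j l) r q
  rw [e] at h
  rw [srcFlattening_eq_map]
  exact le_rank_of_intTriCheckUnit (F := K) _ (rowDec4 c) (colDec4 a) h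

/-- A condition vector that kills the integer role-1 flattening on codes kills it over `K`.
[folklore] -/
theorem vecMul_srcFlattening_eq_zero {a b c : ℕ} [NeZero a] [NeZero b] [NeZero c]
    (T : Fin a → Fin b → Fin c → ℤ) (M : List (List ℤ)) (y : List (ℕ × ℤ))
    (h : ((List.range (4 * a)).all fun qq =>
      (y.map fun rc => rc.2 * kyEntry4 b a c M (fun j i l => T i j l) rc.1 qq).sum == 0) = true) :
    intCertRow (F := K) (rowDec4 c) y ᵥ*
      srcFlattening 4 1 ((mat4 b M).map (Int.cast : ℤ → K)) (fun i j l => (T i j l : K)) = 0 := by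
  classical
  funext col
  obtain ⟨qq, hqq, rfl⟩ := exists_colDec4 a col
  rw [List.all_eq_true] at h
  have h' := h qq (List.mem_range.2 hqq)
  simp only [beq_iff_eq] at h'
  rw [srcFlattening_eq_map]
  simp only [Matrix.vecMul, dotProduct, Matrix.map_apply, Pi.zero_apply]
  rw [sum_intCertRow_mul (F := K) (rowDec4 c)
    (fun i => koszulFlatteningGen 4 1 (mat4 b M).mulVecLin (fun j i l => T i j l) i (colDec4 a qq)) y]
  simp only [← kyEntry4_eq]
  rw [h', Int.cast_zero]

/-- The role-1 linear forms on codes ARE the new-column functionals of `srcFlattening_condition`: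
`∑_{j,l} λ(j,l) Z_{jl} = ∑_{(T,c)} y(T,c) ∑_j (∑_x ε(T,S,x) M_{xj}) Z_{jc}`. [folklore] -/
theorem sum_lamEntry_one {b c : ℕ} [NeZero b] [NeZero c] (M : List (List ℤ)) (y : List (ℕ × ℤ))
    (s : ℕ) (Z : Fin b → Fin c → K) :
    ∑ j : Fin b, ∑ l : Fin c,
      (((y.map fun rc => if rc.1 % c = (l : ℕ) then
          rc.2 * lsum 4 (fun x => incZ4 (rc.1 / c % 6) (s % 4) x * mget M x j) else 0).sum : ℤ) : K) *
        Z j l =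
      ∑ rr : PSub 4 2 × Fin c, intCertRow (F := K) (rowDec4 c) y rr *
        ∑ j, (∑ x, (wedgeInc rr.1.1 (singOf4 (finCode 4 s)).1 x : K) *
          ((mat4 b M).map (Int.cast : ℤ → K)) x j) * Z j rr.2 := by
  classical
  rw [sum_intCertRow_mul' (rowDec4 c)]
  have hinc : ∀ (r : ℕ) (x : Fin 4), incZ4 (r / c % 6) (s % 4) x =
      wedgeInc (pairOf4 (finCode 6 (r / c))).1 (singOf4 (finCode 4 s)).1 x := by
    intro r x
    unfold wedgeInc
    exact incZ4_eq (finCode 6 (r / c)) (finCode 4 s) x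
  induction y with
  | nil => simp
  | cons rc y ih =>
    simp only [List.map_cons, List.sum_cons, Int.cast_add, add_mul, Finset.sum_add_distrib, ih]
    congr 1
    have hl : ∀ l : Fin c, (rc.1 % c = (l : ℕ)) ↔ finCode c rc.1 = l := fun l =>
      ⟨fun h => Fin.ext h, fun h => by rw [← h]; rfl⟩
    simp only [hl, Int.cast_ite, Int.cast_zero, ite_mul, zero_mul, Finset.sum_ite_eq,
      Finset.mem_univ, if_true, Int.cast_mul, lsum_eq, Int.cast_sum, hinc, Finset.mul_sum]
    refine Finset.sum_congr rfl fun j _ => ?_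
    simp only [mat4, Matrix.map_apply, Matrix.of_apply, rowDec4]
    rw [← Finset.mul_sum]
    ring

/-- Linear forms of the empty condition vanish. [folklore] -/
theorem lamEntry_dflt (b c : ℕ) (M1 M3 : List (List ℤ)) (j l : ℕ) : lamEntry b c M1 M3 dflt j l = 0 := by
  simp [lamEntry, dflt]

/-- **Soundness of the sieve certificate.** If `check a b c r T … = true`, `a < r` and
`r ≤ bR(T ⊗ K)`, then `r < bR(T ⊗ K)`, over EVERY field `K`: by (E1)
(`exists_extendSlice_of_finrank_sliceSpan_lt`) border rank `r` would give a new slice `Z ∉ V` with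
`bR(T + e_new ⊗ Z) ≤ r`; the tight roles force `Λ Z = 0` (`srcFlattening_condition`), and
`V ≤ ker Λ`, `rank Λ ≥ bc - a`, `dim V = a` force `ker Λ = V`, a contradiction.
[cite: JagiellaJelisiejew2026Unrestrictions, Thm. 2.2] [cite: LandsbergOttaviani2015, Thm 2.1] -/
theorem lt_algBorderRank_of_check (K : Type u) [Field K] {a b c r : ℕ} [NeZero a] [NeZero b]
    [NeZero c] (T : Fin a → Fin b → Fin c → ℤ) {M1 M3 : List (List ℤ)} {conds : List Cond}
    {rows1 rows3 rowsL rowsS : List (List (ℕ × ℤ))} {piv1 piv3 pivL pivS : List ℕ}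
    (h : check a b c r T M1 M3 conds rows1 piv1 rows3 piv3 rowsL pivL rowsS pivS = true)
    (har : a < r) (hr : r ≤ algBorderRank (fun i j l => (T i j l : K))) :
    r < algBorderRank (fun i j l => (T i j l : K)) := by
  classical
  -- unpack the check
  unfold check at h
  simp only [Bool.and_eq_true] at h
  obtain ⟨⟨⟨⟨⟨hconds, hcap1⟩, hcap3⟩, hkill⟩, hL⟩, hS⟩ := h
  rw [List.all_eq_true] at hconds
  set tK : Fin a → Fin b → Fin c → K := fun i j l => (T i j l : K) with htK
  set M1K : Matrix (Fin 4) (Fin b) K := (mat4 b M1).map (Int.cast : ℤ → K) with hM1K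
  set M3K : Matrix (Fin 4) (Fin c) K := (mat4 c M3).map (Int.cast : ℤ → K) with hM3K
  -- the linear map Λ
  set ΛK : Matrix (Fin (b * c)) (Fin b × Fin c) K := (lamMat b c M1 M3 conds).map (Int.cast : ℤ → K)
    with hΛK
  set Ψ : (Fin b → Fin c → K) →ₗ[K] (Fin (b * c) → K) :=
    ΛK.mulVecLin ∘ₗ (LinearEquiv.curry K K (Fin b) (Fin c)).symm.toLinearMap with hΨ
  have hΨapply : ∀ (Z : Fin b → Fin c → K) (k : Fin (b * c)),
      Ψ Z k = ∑ j : Fin b, ∑ l : Fin c, (lamEntry b c M1 M3 (conds.getD k dflt) j l : K) * Z j l := by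
    intro Z k
    simp only [hΨ, LinearMap.coe_comp, Function.comp_apply, Matrix.mulVecLin_apply, Matrix.mulVec,
      dotProduct, Fintype.sum_prod_type, hΛK, Matrix.map_apply, lamMat, Matrix.of_apply]
    rfl
  refine lt_algBorderRank_of_card_lt_of_forall_extendSlice tK (by simpa using har) hr fun Z hZ => ?_
  by_contra hle'
  have hle : algBorderRank (extendSlice tK Z) ≤ r := le_of_not_gt hle'
  apply hZ
  -- (1) Ψ Z = 0
  have hΨZ : Ψ Z = 0 := by
    funext k
    rw [hΨapply, Pi.zero_apply]
    by_cases hk : (k : ℕ) < conds.length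
    · have hmem : conds.getD k dflt ∈ conds := by
        rw [List.getD_eq_getElem?_getD, List.getElem?_eq_getElem hk, Option.getD_some]
        exact List.getElem_mem hk
      set cd := conds.getD k dflt with hcd
      have hvan := hconds cd hmem
      by_cases h1 : cd.1 = 1
      · -- role 1
        have hany : (conds.any fun cd => cd.1 == 1) = true := List.any_eq_true.2 ⟨cd, hmem, by simp [h1]⟩
        simp only [hany, Bool.not_true, Bool.false_or] at hcap1
        simp only [condVanish, h1, if_true] at hvan
        have hcap := le_rank_srcFlattening (K := K) T M1 hcap1
        have hy := vecMul_srcFlattening_eq_zero (K := K) T M1 cd.2.1 hvan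
        have key := srcFlattening_condition 4 1 M1K tK Z hle (by simpa using hcap) _ hy
          (singOf4 (finCode 4 cd.2.2))
        simp only [lamEntry, h1, if_true]
        rw [sum_lamEntry_one]
        exact key
      · -- role 3: the same for `(i, l, j) ↦ T i j l` and `Zᵀ`
        have hany : (conds.any fun cd => !(cd.1 == 1)) = true :=
          List.any_eq_true.2 ⟨cd, hmem, by simp [h1]⟩
        simp only [hany, Bool.not_true, Bool.false_or] at hcap3
        simp only [condVanish, h1, if_false] at hvan
        have hcap := le_rank_srcFlattening (K := K) (fun i l j => T i j l) M3 hcap3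
        have hy := vecMul_srcFlattening_eq_zero (K := K) (fun i l j => T i j l) M3 cd.2.1 hvan
        have hext : algBorderRank (extendSlice (fun i l j => tK i j l) fun l j => Z j l) ≤ r := by
          have e : (extendSlice (fun i l j => tK i j l) fun l j => Z j l) =
              fun x l j => extendSlice tK Z x j l := by
            funext x l j; cases x <;> rfl
          rw [e, algBorderRank_swap₂₃ (extendSlice tK Z)]
          exact hle
        have key := srcFlattening_condition 4 1 M3K (fun i l j => tK i j l) (fun l j => Z j l) hext
          (by simpa using hcap) _ hy (singOf4 (finCode 4 cd.2.2))
        simp only [lamEntry, h1, if_false]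
        rw [Finset.sum_comm, sum_lamEntry_one]
        exact key
    · have hk' : conds.length ≤ (k : ℕ) := le_of_not_gt hk
      have hcd : conds.getD k dflt = dflt := by
        rw [List.getD_eq_getElem?_getD, List.getElem?_eq_none hk', Option.getD_none]
      rw [hcd]
      simp [lamEntry_dflt]
  -- (2) V ≤ ker Ψ
  have hV : sliceSpan tK ≤ LinearMap.ker Ψ := by
    rw [sliceSpan, Submodule.span_le]
    rintro _ ⟨i, rfl⟩
    rw [SetLike.mem_coe, LinearMap.mem_ker]
    funext k
    rw [hΨapply, Pi.zero_apply]
    unfold slicesKilled at hkill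
    rw [List.all_eq_true] at hkill
    have h1 := hkill k (List.mem_range.2 k.isLt)
    rw [List.all_eq_true] at h1
    have h2 := h1 i (List.mem_range.2 i.isLt)
    rw [beq_iff_eq, lsum_eq] at h2
    simp only [lsum_eq] at h2
    have hfa : finCode a (i : ℕ) = i := Fin.ext (Nat.mod_eq_of_lt i.isLt)
    have hfb : ∀ j : Fin b, finCode b (j : ℕ) = j := fun j => Fin.ext (Nat.mod_eq_of_lt j.isLt)
    have hfc : ∀ l : Fin c, finCode c (l : ℕ) = l := fun l => Fin.ext (Nat.mod_eq_of_lt l.isLt)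
    simp only [hfa, hfb, hfc] at h2
    have h3 := congrArg (Int.cast : ℤ → K) h2
    simpa [Int.cast_sum, Int.cast_mul, htK] using h3
  -- (3) rank Ψ ≥ bc - a
  have hrange : b * c - a ≤ Module.finrank K (LinearMap.range Ψ) := by
    have htop : LinearMap.range (LinearEquiv.curry K K (Fin b) (Fin c)).symm.toLinearMap = ⊤ :=
      LinearEquiv.range _
    rw [hΨ, LinearMap.range_comp_of_range_eq_top _ htop]
    have hneq : NeZero (b * c) := ⟨Nat.mul_ne_zero (NeZero.ne b) (NeZero.ne c)⟩
    have := le_rank_of_intTriCheckUnit (F := K) (lamMat b c M1 M3 conds) (finCode (b * c))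
      (slabDec b c) hL
    exact this
  -- (4) dim V = a
  have hVdim : a ≤ Module.finrank K (sliceSpan tK) := by
    have hrk := le_rank_of_intTriCheckUnit (F := K) (slab₁ T) (finCode a) (slabDec b c) hS
    have em : (slab₁ T).map (Int.cast : ℤ → K) = slab₁ tK := rfl
    rw [em] at hrk
    have hli := linearIndependent_of_card_le_rank_slab₁ tK (by simpa using hrk)
    rw [sliceSpan, finrank_span_eq_card hli, Fintype.card_fin]
  -- (5) dimension count
  have hdim : Module.finrank K (Fin b → Fin c → K) ≤ (b * c - a) + a := by
    have h1 : Module.finrank K (Fin b → Fin c → K) = b * c := by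
      rw [Module.finrank_pi_fintype K]
      simp [Module.finrank_fintype_fun_eq_card]
    have h2 : Module.finrank K (sliceSpan tK) ≤ Module.finrank K (Fin b → Fin c → K) :=
      Submodule.finrank_le _
    omega
  exact mem_of_le_ker_of_finrank Ψ (sliceSpan tK) hV hdim hrange hVdim hΨZ

/-- Transport: a sieve certificate for the rotated tensor `(j, l, i) ↦ T i j l` (extended factor = the
SECOND factor of `T`) bounds `bR(T)` (`algBorderRank_rotate`). [cite: Blaser2013, §5.1 (permutation of tensors)] -/
theorem lt_algBorderRank_of_check_rotate₁ (K : Type u) [Field K] {a b c r : ℕ} [NeZero a] [NeZero b]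
    [NeZero c] (T : Fin a → Fin b → Fin c → ℤ) {M1 M3 : List (List ℤ)} {conds : List Cond}
    {rows1 rows3 rowsL rowsS : List (List (ℕ × ℤ))} {piv1 piv3 pivL pivS : List ℕ}
    (h : check b c a r (fun j l i => T i j l) M1 M3 conds rows1 piv1 rows3 piv3 rowsL pivL rowsS pivS =
      true)
    (hbr : b < r) (hr : r ≤ algBorderRank (fun i j l => (T i j l : K))) :
    r < algBorderRank (fun i j l => (T i j l : K)) := by
  have hr' : r ≤ algBorderRank (fun j l i => (T i j l : K)) := by
    rw [← algBorderRank_rotate (fun i j l => (T i j l : K))] at hr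
    exact hr
  have key := lt_algBorderRank_of_check K (fun j l i => T i j l) h hbr hr'
  rw [← algBorderRank_rotate (fun i j l => (T i j l : K))]
  exact key

/-- Transport: a sieve certificate for the rotated tensor `(l, i, j) ↦ T i j l` (extended factor = the
THIRD factor of `T`) bounds `bR(T)` (`algBorderRank_rotate` twice). [cite: Blaser2013, §5.1 (permutation of tensors)] -/
theorem lt_algBorderRank_of_check_rotate₂ (K : Type u) [Field K] {a b c r : ℕ} [NeZero a] [NeZero b]
    [NeZero c] (T : Fin a → Fin b → Fin c → ℤ) {M1 M3 : List (List ℤ)} {conds : List Cond}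
    {rows1 rows3 rowsL rowsS : List (List (ℕ × ℤ))} {piv1 piv3 pivL pivS : List ℕ}
    (h : check c a b r (fun l i j => T i j l) M1 M3 conds rows1 piv1 rows3 piv3 rowsL pivL rowsS pivS =
      true)
    (hcr : c < r) (hr : r ≤ algBorderRank (fun i j l => (T i j l : K))) :
    r < algBorderRank (fun i j l => (T i j l : K)) := by
  have hr' : r ≤ algBorderRank (fun l i j => (T i j l : K)) := by
    rw [← algBorderRank_rotate (fun i j l => (T i j l : K)), ← algBorderRank_rotate] at hr
    exact hr
  have key := lt_algBorderRank_of_check K (fun l i j => T i j l) h hcr hr'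
  rw [← algBorderRank_rotate (fun i j l => (T i j l : K)), ← algBorderRank_rotate]
  exact key

end Sound

end SieveCert

end Literature.Computability.AlgebraicComplexity
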